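import Summits.HodgeConjecture.HodgeConjecture.Theses.PadicSemiregularLift
import Summits.HodgeConjecture.HodgeConjecture.Cruxes.SemiregularSeedsOnAnchors.TypedCrux
import Literature.AlgebraicGeometry.HodgeTheory.AtiyahClassTraceReal
import Literature.AlgebraicGeometry.Motives.CompleteIntersection
import Literature.AlgebraicGeometry.Motives.SupersingularAbelianVariety
import Literature.AlgebraicGeometry.Motives.HypersurfaceFormsNonsingular

/-!
# Line `gorenstein-ci-seeds` — skeleton for crux `SemiregularSeedsOnAnchors` (stmt-HodgeConjecture-13941)

Route `PadicSemiregularLift`, crux P2a (rank 3). Idea card `Ideas/gorenstein-ci-seeds.md`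
(crux-ideate r1, ideator 3; triage r1-1/2/3: pass/pass/pass). Crux-plan generation 2
(2026-08-16): §1–§3 and the dictionary of §4 are the generation-1 skeleton of this line
(`planner-cruxplan-…-gorenstein-ci-seeds-0`, same path, superseded by this file) kept with their
registered stub names; generation 2 (i) concludes the SHARED typed crux
`Cruxes.SemiregularSeedsOnAnchors.SemiregularSeedsOnAnchors C Θ HO` of `TypedCrux.lean` BY NAME
(the route item is informal, `signature: null`; every line of this crux is audited against that
decl: `ledger skeleton check Lines/gorenstein-ci-seeds.lean --crux stmt-HodgeConjecture-13941
--crux-decl Summit.HodgeConjecture.HodgeConjecture.Cruxes.SemiregularSeedsOnAnchors.SemiregularSeedsOnAnchors`),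
(ii) cuts the supply stub along the line drawn by a saturation census of all totally-Hodge
characters of `X⁴_m`, `m ≤ 36` (`comp/saturation_census.py` of this seat, line card §Census):
three-pair characters (`stub_linearCycleSupply`, PROVABLE — linear cycles, visible and liftable),
saturated non-pair characters (`stub_eigenCISupply`, the OPEN BET), unsaturated characters (out of
this line's reach on real carriers — they need extra vanishings `[Z]_{ja} = 0` in Hodge types
`(3,1)/(1,3)`, invisible in the Jacobian ring — and therefore in the residual), and (iii) carries
the honest remainder of P2a (every anchor / class outside the Fermat-fourfold saturated scope:
abelian anchors, Fermat `n ≥ 6`, unsaturated orbits, other `W`-models) as ONE registered residual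
stub, exactly as the sibling line `isogeny-untwist-superspecial` does for its secant scope, so that
the lead sees the two scopes side by side and the tenure planner can `--split` P2a by anchor class
(all three triagers' cross-cutting recommendation), after which the residual leaves this skeleton.

## Lead's reshape (prover-line-stmt-HodgeConjecture-13941-0, 2026-08-16)

The lead AUDITS THE RESIDUAL-FREE SCOPE THEOREM: `SemiregularSeedsOnAnchors_of : S1 → S2 → S3 → S4a →
S4b → SemiregularSeedsOnFermatScope` (`--crux-decl …GorensteinCiSeeds.SemiregularSeedsOnFermatScope`).
Generation 2's sixth stub `stub_residualOffFermatScope` and the by-name composition through it are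
DROPPED from this skeleton: the residual is not a lemma of this line, and as a closed statement it
quantifies over a FREE Hodge-origin predicate `HO`, so it specialises to `HO := ⊤`, which is false on
paper (`Disproof.withoutHodgeOrigin_count`, CRUX-ATTACK-g2 §3) though not refutable in Lean over an
abstract `C`; carrying it would register an unprovable, intent-false stub. The line's vocabulary
(§1–§3 and the five stub statements) is ALSO filed verbatim as
`Theorems/PadicSemiregularLiftSemiregularSeedsOnAnchorsDefs.lean` (namespace
`Summit.HodgeConjecture.HodgeConjecture.Theorems.SemiregularSeedsOnAnchors.GorensteinCiSeeds`) so that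
stub files under `Theorems/` can import it; once that file lands this skeleton imports it and drops its
inline copies (stub names and signatures unchanged).

## The line (card + triage sharpenings)

For a CI-type surface `Z = V₊(f₁,f₂,f₃) ⊂ X = V₊(F) ⊂ ℙ⁵`, `F = Σ fᵢ gᵢ`, `1 ≤ deg fᵢ < m`:
Cramer on `∇F = Jac(H)ᵀ·(g,f)` gives `⟨f,g⟩ ⊆ (J^F : P)`, `P = det Jac(H)`; both are Artinian
Gorenstein of socle degree `3m − 6`, hence EQUAL (`stub_jacobianColon_eq`, Villaflor Rem. 1), and
`P ∉ J^F` (corollary `transitionDet_not_mem_of_colon_eq`); Villaflor Cor. 3 then gives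
`rank(⌟[Z] : H¹(T_X) → H^{1,3}) = dim A_m`, `A = k[x]/⟨f,g⟩`, while Koszul gives
`h¹(N_{Z/X}) = dim A_m`; Bloch / Buchweitz–Flenner 4.2: `⌟[Z] = π_Z ∘ ob`, so `ob` is onto and
`π_Z` injective on `H¹(N_{Z/X}) ⊇ Ext²(E_Z, E_Z)` for the Hartshorne–Serre bundle `E_Z`
(`stub_serreBundle_exists` + `stub_serreBundle_isOneSemiregular`, the LEVER — real carriers
`sigmaOne` / `IsOneSemiregular`, no p-adics). SUPPLY: for every saturated character `a` of `X⁴_m` a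
reduced CI-type factorisation of the Fermat form over `𝔽̄_p`, VISIBLE at `a` (the
`x^{a−1}`-coefficient of `P` is non-zero) and GOOD (`H_a`-stable — Hodge condition by character
bookkeeping — or liftable to `W(k)` — Hodge condition by lifting): linear cycles for three-pair `a`
(`stub_linearCycleSupply`), eigen-CI's for non-pair `a` (`stub_eigenCISupply`). Composition
`SemiregularSeedsOnAnchors_of`: case split on the scope; in scope linear algebra over `K` through the
posited `FermatLiftDictionary`; off scope the residual stub.

## Disproof used

`Cruxes/SemiregularSeedsOnAnchors/Disproof.lean` (cdisprove cycle 1; re-read 2026-08-16T01:30Z): no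
`_false_without_<H>` theorem and no `-- Targets` stub kill exist (informal crux). §A (redecoration:
`not_isSemiregular_killTrace`, `isSemiregular_tautological`) is WHY semiregularity is typed with the
REAL `σ₀, σ₁` (`IsOneSemiregular`, `IsPadicSemiregular Θ` with `σ₀, σ₁` pinned) and never over
`AtiyahTraceAlgebra`; §B `finrank_ext_le_of_isSemiregular` (forced kernel) is respected with room to
spare: `ext²(E_Z,E_Z) ≤ h¹(N_{Z/X}) = dim A_m = rank(⌟[Z]) ≤ h^{1,3}`; §C `cubicFourfold_*`: `m = 3`,
`dᵢ = 1` gives `dim A₃ = 1 = τ`, the plane bundles of CRUX-ATTACK §E; §A-doc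
`withoutHodgeOrigin_count` (HO load-bearing) is why `HO` stays a hypothesis of the residual and is
never assumed `⊤`. The landed `Theorems/SemiregularSeedsOnAnchors/Negative/SemiregularityCarrier.lean`
(p70720: abstract-carrier and abelian/cubic counting lemmas) refutes no instance of any stub below
(no stub mentions `AtiyahTraceAlgebra`; S1–S4 are statements about polynomials and sheaves on `X_k`).
-/

set_option linter.dupNamespace false

noncomputable section

open CategoryTheory AlgebraicGeometry
open scoped Isocrystal
open Literature.AlgebraicGeometry.Motives Literature.AlgebraicGeometry.Motives.WittScheme
open Literature.AlgebraicGeometry.HodgeTheory Literature.AlgebraicGeometry.Modules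

universe u

namespace Summit.HodgeConjecture.HodgeConjecture.Cruxes.SemiregularSeedsOnAnchors.GorensteinCiSeeds

/-! ## §1 Commutative algebra of CI-type data (`k[x₀,…,x₅]`) -/

section Algebra

variable {k : Type u} [Field k]

/-- The Jacobian ideal `J^F = (∂₀F, …, ∂₅F)`. -/
def jacobianIdeal (F : MvPolynomial (Fin 6) k) : Ideal (MvPolynomial (Fin 6) k) :=
  Ideal.span (Set.range fun j : Fin 6 => MvPolynomial.pderiv j F)

/-- A REDUCED CI-TYPE DATUM for a form `F` of degree `m` in six variables: homogeneous
`f₁,f₂,f₃,g₁,g₂,g₃ ≠ 0` with `deg fᵢ = dᵢ`, `deg gᵢ = m − dᵢ`, `1 ≤ dᵢ < m` (so every `gᵢ` is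
non-constant too), `Σ fᵢ gᵢ = F`, and `(f₁,f₂,f₃)` a radical ideal (so that the tree's REDUCED
`completeIntersection f` is the complete-intersection scheme `V₊(f₁,f₂,f₃) ⊂ ℙ⁵`, the surface `Z` of
the card when `X = V₊(F)` is smooth: a common zero of the `fᵢ, gᵢ` would be a singular point of `X`,
so `(f,g)` is a regular sequence and `(f)` has codimension `3`). [Villaflor arXiv:1812.03964 §1;
Movasati–Villaflor arXiv:1705.00084 (the case `dᵢ = 1`)] -/
structure CIDatum (F : MvPolynomial (Fin 6) k) (m : ℕ) where
  /-- degrees of the `fᵢ` -/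
  d : Fin 3 → ℕ
  /-- the forms cutting out `Z` -/
  f : Fin 3 → MvPolynomial (Fin 6) k
  /-- the complementary forms -/
  g : Fin 3 → MvPolynomial (Fin 6) k
  one_le_d : ∀ i, 1 ≤ d i
  d_lt : ∀ i, d i < m
  f_hom : ∀ i, (f i).IsHomogeneous (d i)
  g_hom : ∀ i, (g i).IsHomogeneous (m - d i)
  f_ne : ∀ i, f i ≠ 0
  g_ne : ∀ i, g i ≠ 0
  sum_eq : ∑ i, f i * g i = F
  radical : (Ideal.span (Set.range f)).IsRadical

namespace CIDatum

variable {F : MvPolynomial (Fin 6) k} {m : ℕ}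

/-- The six forms `H = (f₁,f₂,f₃,g₁,g₂,g₃)`. -/
def H (Z : CIDatum F m) : Fin 6 → MvPolynomial (Fin 6) k :=
  fun i => Sum.elim Z.f Z.g ((finSumFinEquiv (m := 3) (n := 3)).symm (Fin.cast rfl i))

/-- The ideal `⟨f, g⟩ = (H₀, …, H₅)`; `A = k[x]/⟨f,g⟩` is the Artinian Gorenstein algebra of the card. -/
def ideal (Z : CIDatum F m) : Ideal (MvPolynomial (Fin 6) k) :=
  Ideal.span (Set.range Z.H)

/-- The TRANSITION DETERMINANT `P_Z = det (∂ⱼ Hᵢ)` (Villaflor's `det Jac(H)`: the class `[Z]_prim`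
corresponds to `c · P_Z`, `c ≠ 0`, under `H^{2,2}_prim ≅ R^F_{3m−6}` [Villaflor arXiv:1812.03964,
Thm 1]). It is homogeneous of degree `Σ(dᵢ − 1) + Σ(m − dᵢ − 1) = 3m − 6`. -/
def transitionDet (Z : CIDatum F m) : MvPolynomial (Fin 6) k :=
  Matrix.det (Matrix.of fun i j : Fin 6 => MvPolynomial.pderiv j (Z.H i))

/-- Every `Hᵢ` is homogeneous of POSITIVE degree. -/
theorem exists_isHomogeneous_H (Z : CIDatum F m) (i : Fin 6) :
    ∃ n, 0 < n ∧ (Z.H i).IsHomogeneous n := by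
  unfold CIDatum.H
  cases (finSumFinEquiv (m := 3) (n := 3)).symm (Fin.cast rfl i) with
  | inl a => exact ⟨Z.d a, Z.one_le_d a, Z.f_hom a⟩
  | inr a => exact ⟨m - Z.d a, Nat.sub_pos_of_lt (Z.d_lt a), Z.g_hom a⟩

/-- `⟨f, g⟩` is a proper ideal (all generators have positive degree: constant coefficients vanish). -/
theorem ideal_ne_top (Z : CIDatum F m) : Z.ideal ≠ ⊤ := by
  intro htop
  have key : ∀ q ∈ Z.ideal, MvPolynomial.constantCoeff q = 0 := by
    intro q hq
    refine Submodule.span_induction ?_ ?_ ?_ ?_ hq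
    · rintro _ ⟨i, rfl⟩
      obtain ⟨n, hn, hhom⟩ := Z.exists_isHomogeneous_H i
      rw [MvPolynomial.constantCoeff_eq]
      exact hhom.coeff_eq_zero (by rw [map_zero]; exact hn.ne)
    · simp
    · intro x y _ _ hx hy
      simp [hx, hy]
    · intro a x _ hx
      simp [hx]
  have h1 : (1 : MvPolynomial (Fin 6) k) ∈ Z.ideal := htop ▸ Submodule.mem_top
  simpa using key 1 h1

end CIDatum

/-- Linkage, the half NOT registered as a stub (a corollary of S1, recorded for the provers):
`P_Z ∉ J^F` follows from `(J^F : P_Z) = ⟨f,g⟩ ≠ (1)` — i.e. `[Z]_prim ≠ 0` (TRIAGE r1-2 caveat). -/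
theorem transitionDet_not_mem_of_colon_eq {F : MvPolynomial (Fin 6) k} {m : ℕ} (Z : CIDatum F m)
    (hcolon : (jacobianIdeal F).colon {Z.transitionDet} = Z.ideal) :
    Z.transitionDet ∉ jacobianIdeal F := by
  intro hmem
  apply Z.ideal_ne_top
  rw [← hcolon, eq_top_iff]
  intro r _
  rw [Submodule.mem_colon]
  rintro q rfl
  exact Ideal.mul_mem_left _ r hmem

/-- Statement of STUB S1 (pure commutative algebra, size M; the Gorenstein step of the lever): for
a nonsingular form `F` of degree `m ≥ 3` with `m ≠ 0` in `k` (so that, by Euler, `J^F` is generated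
by a regular sequence and `R/J^F` is Artinian Gorenstein of socle degree `6m − 12`) and any CI-type
datum, `(J^F : P_Z) = ⟨f, g⟩`. Proof in print: `∂ⱼF = Σᵢ (∂ⱼgᵢ) fᵢ + (∂ⱼfᵢ) gᵢ` exhibits
`J^F = N·⟨H⟩` with `det N = ±P_Z`; `⟨H⟩` is generated by a regular sequence of length `6` (a common
zero of the `fᵢ, gᵢ` is a common zero of `F` and `∇F`), `J^F ⊆ ⟨H⟩`; linkage gives
`(J : ⟨H⟩) = J + (P_Z)` and the Gorenstein double annihilator `(J : (J : ⟨H⟩)) = ⟨H⟩`, whence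
`(J : P_Z) = ⟨H⟩` — equivalently: Cramer (`adj(Jac H)·∇F = P_Z·(g,f)`) gives `⊇`, and two Artinian
Gorenstein ideals of the same socle degree `3m − 6`, one inside the other, coincide.
[Villaflor arXiv:1812.03964 Remark 1, Thm 1 and Thm 5 (Macaulay); linkage: Peskine–Szpiro 1974 /
Bruns–Herzog §2.3; TRIAGE r1-1/2/3 re-derivations] -/
def JacobianColonEq : Prop :=
  ∀ (k : Type u) [Field k] (m : ℕ) (_ : 3 ≤ m) (_ : (m : k) ≠ 0)
    (F : MvPolynomial (Fin 6) k) (_ : F.IsHomogeneous m)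
    (_ : SmoothHypersurface.IsNonsingularForm k F) (Z : CIDatum F m),
    (jacobianIdeal F).colon {Z.transitionDet} = Z.ideal

end Algebra

/-! ## §2 Geometry: the Hartshorne–Serre bundle of a CI-type surface is 1-semiregular (the LEVER) -/

section Geometry

variable {k : Type u} [Field k]

/-- `ι : X ⟶ ℙ⁵_k` has image the zero locus `V₊(F)` (the shape of `Motives.IsHypersurfaceCutOutBy`,
which `IsFermatVariety 4 m X` provides for the Fermat form). -/
def HasRangeZeroLocus {X : SchemeOver k} (ι : X ⟶ projectiveSpace 5 k)
    (F : MvPolynomial (Fin 6) k) : Prop :=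
  letI := MvPolynomial.gradedAlgebra (σ := Fin 6) (R := k)
  Set.range ι.left.base =
    ProjectiveSpectrum.zeroLocus (MvPolynomial.homogeneousSubmodule (Fin 6) k) {F}

/-- `E` IS A HARTSHORNE–SERRE BUNDLE OF `Z = V₊(f) ∩ X` (through the FIXED embedding `ι`), on real
carriers: the reduced complete intersection `completeIntersection f ↪ ℙ⁵` factors through `X` by some
`j`, and there are a line bundle `L` on `X`, a line bundle `L_Z` on `Z` and maps
`𝒪_X →ˢ E →ᵗ L →ᵛ j_*L_Z` with `s` mono, `v` epi, and `(s,t)`, `(t,v)` exact. Then `v♭ : j^*L → L_Z`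
is an epimorphism of line bundles, hence an isomorphism, so `im t = ker v = 𝓘_Z·L`, i.e.
`0 → 𝒪_X → E → 𝓘_Z ⊗ L → 0` is the Hartshorne–Serre extension; for `E` locally free of rank `2` on a
smooth hypersurface fourfold (`Pic = ℤ·𝒪(1)`) this forces `Z(s) = Z` scheme-theoretically,
`L ≅ det E ≅ 𝒪_X(Σdᵢ − m)` and `E ≅ E_Z` up to isomorphism (`Ext¹(𝓘_Z ⊗ L, 𝒪_X) ≅ H⁰(𝒪_Z) = k`,
`Z` a connected reduced CI surface). [Hartshorne–Serre correspondence: Arrondo, Rev. Mat. Complut.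
20 (2007) Thm 1.1; Hartshorne, Bull. AMS 80 (1974)] -/
def IsHartshorneSerreOf {X : SchemeOver k} (ι : X ⟶ projectiveSpace 5 k)
    (f : Fin 3 → MvPolynomial (Fin 6) k) (E : X.left.Modules) : Prop :=
  ∃ (j : completeIntersection f ⟶ X) (_ : j ≫ ι = completeIntersectionι f)
    (L : X.left.Modules) (_ : HasRank L 1)
    (LZ : (completeIntersection f).left.Modules) (_ : HasRank LZ 1)
    (s : unitModule X.left ⟶ E) (t : E ⟶ L)
    (v : L ⟶ (Scheme.Modules.pushforward j.left).obj LZ)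
    (hst : s ≫ t = 0) (htv : t ≫ v = 0),
    Mono s ∧ Epi v ∧ (ShortComplex.mk s t hst).Exact ∧ (ShortComplex.mk t v htv).Exact

/-- Statement of STUB S2 — HARTSHORNE–SERRE EXISTENCE (real carriers; classical, size L to
formalise): for `k` algebraically closed, `F` a nonsingular form of degree `m ≥ 3` (`m ≠ 0` in `k`),
`X` smooth projective of dimension `4` with a closed immersion `ι : X ↪ ℙ⁵` onto `V₊(F)`, and a
reduced CI-type datum `Z`, the Hartshorne–Serre bundle of the surface `V₊(f) = V₊(f) ∩ X` EXISTS: a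
finite locally free `𝒪_X`-module of rank `2` with `IsHartshorneSerreOf ι Z.f E`. Paper proof: `Z` is
a codimension-`2` local complete intersection in `X` (`𝒪_{Z,z} = 𝒪_{ℙ,z}/(f)` is a CI quotient of
the regular `𝒪_{X,z}`), `det N_{Z/X} = 𝒪_Z(Σdᵢ − m)` extends to `L = 𝒪_X(Σdᵢ − m)`, and
`H²(X, L^∨) = 0` (`Hⁱ(𝒪_X(j)) = 0`, `0 < i < 4`); take `L_Z = j^*L`, `v` the unit `L → j_*j^*L`.
[Arrondo, Rev. Mat. Complut. 20 (2007) Thm 1.1; Hartshorne, Bull. AMS 80 (1974); Vogelaar's thesis] -/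
def SerreBundleExists : Prop :=
  ∀ (k : Type u) [Field k] [IsAlgClosed k] (m : ℕ) (_ : 3 ≤ m) (_ : (m : k) ≠ 0)
    (F : MvPolynomial (Fin 6) k) (_ : F.IsHomogeneous m)
    (_ : SmoothHypersurface.IsNonsingularForm k F)
    (X : SchemeOver k) (_ : IsSmoothProjective 4 X)
    (ι : X ⟶ projectiveSpace 5 k) [IsClosedImmersion ι.left] (_ : HasRangeZeroLocus ι F)
    (Z : CIDatum F m),
    ∃ (E : X.left.Modules) (_ : IsFiniteLocallyFree E), HasRank E 2 ∧ IsHartshorneSerreOf ι Z.f E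

/-- Statement of STUB S3 — THE LEVER (real carriers; size XL to formalise, the card's new theorem on
paper; HARDEST). In the setting of S2, in characteristic `0` or `> 6`, with `P_Z ∉ J^F` and
`(J^F : P_Z) = ⟨f,g⟩` (S1 and its corollary): EVERY rank-`2` finite locally free Hartshorne–Serre
bundle `E` of `V₊(f) ∩ X` (there is one up to isomorphism, see `IsHartshorneSerreOf`) is
`1`-SEMIREGULAR: `σ₁ : Ext²(E,E) → H³(X, Ω¹_{X/k})` (`AtiyahClassTraceReal.sigmaOne`) is injective.
Paper proof (card; checked line by line by TRIAGE r1-1/2/3; the bundle transfer sharpened by this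
seat): (i) `Ext²(E,𝒪) = H²(E(−c)) = H²(𝓘_Z) = H¹(𝒪_Z) = 0` and `Extⁱ(𝒪, 𝓘_Z(c)) = Hⁱ(𝓘_Z(c)) = 0`
(`i = 1, 2`; `Z` ACM) give `Ext²(E,E) = ker(Ext²(𝓘_Z,𝓘_Z) → Ext³(E,𝒪))` and the local-to-global
sequence (`𝓔xt²(𝓘_Z,𝓘_Z) = 0`, `H²(𝒪_X) = H³(𝒪_X) = 0`) gives `Ext²(𝓘_Z,𝓘_Z) ≅ H¹(N_{Z/X})`, so
`Ext²(E_Z,E_Z) ↪ H¹(N_{Z/X})` (equality iff `H³(E(−c)) → H³(𝓘_Z) = H²(𝒪_Z)` vanishes on the image;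
`p_g(Z) ≠ 0` in general — TRIAGE r1-3 — but an INJECTION is all that is needed), compatibly with
`σ₁ ↔ π_Z` (Buchweitz–Flenner naturality for the HS sequence: the first thing to write);
(ii) `h¹(N_{Z/X}) = dim A_m`, `A = k[x]/⟨f,g⟩` (Koszul `0 → N → ⊕𝒪_Z(dᵢ) → 𝒪_Z(m) → 0`, `Z` ACM,
`H¹(𝒪_Z(j)) = 0`); (iii) `rank(⌟[Z] : H¹(T_X) ≅ R_m → H^{1,3} ≅ R_{4m−6}) = codim (J:P_Z)_m = dim A_m`
(Villaflor Thm 1 + Cor 3 + S1; Jacobian-ring description of `H^{p,q}` and of the Kodaira–Spencer /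
contraction maps in characteristic `p > 5`, `p ∤ m`: Katz, Deligne SGA 7 XI); (iv) Bloch /
Buchweitz–Flenner Prop 4.2 `⌟[Z] = π_Z ∘ ob`, so `rank(π_Z ∘ ob) = dim H¹(N)` forces `ob` onto and
`π_Z` injective, hence `σ₁|_{Ext²(E,E)}` injective. Closes the gap "it is not known if the complete
intersection subvarieties are semi-regular" (Villaflor p. 4); prior art to cite or differentiate:
Dan–Kaur, C. R. Math. 354 (2016) ("semi-regular varieties and variational Hodge conjecture"), Dan 2017
(TRIAGE r1-1 (a)). Consistent with CRUX-ATTACK §E (186/186 full-rank runs = the case `dᵢ = 1`) and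
`Disproof.lean` §B/§C. Why it might fail: the compatibility `σ₁ ↔ π_Z` on `Ext²(E_Z,E_Z) ⊂ H¹(N)` for
`dᵢ > 1`; the char-`p` Jacobian dictionary and Villaflor's `c ≠ 0` in characteristic `p` (an algebraic
— Grothendieck-residue — proof of Thm 1 is needed; the card also asks `p ∤ m − 1`, dropped here as it
would exclude genuine anchors, e.g. `m = 12, p = 11` — restore it if the proof needs it).
[Villaflor arXiv:1812.03964 Thm 1, Rem 1, Cor 3, p. 4; Bloch 1972 Invent. Math. 17;
BuchweitzFlenner2003 Prop 4.2; arXiv:1705.00084] -/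
def SerreBundleIsOneSemiregular : Prop :=
  ∀ (k : Type u) [Field k] [IsAlgClosed k] (m : ℕ) (_ : 3 ≤ m) (_ : (m : k) ≠ 0)
    (_ : ∀ q : ℕ, q.Prime → (q : k) = 0 → 6 < q)
    (F : MvPolynomial (Fin 6) k) (_ : F.IsHomogeneous m)
    (_ : SmoothHypersurface.IsNonsingularForm k F)
    (X : SchemeOver k) (_ : IsSmoothProjective 4 X)
    (ι : X ⟶ projectiveSpace 5 k) [IsClosedImmersion ι.left] (_ : HasRangeZeroLocus ι F)
    (Z : CIDatum F m) (_ : Z.transitionDet ∉ jacobianIdeal F)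
    (_ : (jacobianIdeal F).colon {Z.transitionDet} = Z.ideal)
    (E : X.left.Modules) (hE : IsFiniteLocallyFree E) (_ : HasRank E 2)
    (_ : IsHartshorneSerreOf ι Z.f E),
    IsOneSemiregular.{u + 1} hE

end Geometry

/-! ## §3 Characters of the Fermat fourfold and CI-type supply (pure combinatorics / algebra) -/

section Characters

variable {k : Type u} [Field k]

/-- ADMISSIBLE character of `X⁴_m`: `a : (ℤ/m)⁶`, all `aᵢ ≠ 0`, `Σ aᵢ = 0` (Shioda's `𝔄⁴_m`; these
index the one-dimensional eigenspaces `V_a` of `H⁴_prim`). [Shioda1979HodgeFermat §1] -/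
def IsAdmissible (m : ℕ) (a : Fin 6 → ZMod m) : Prop :=
  (∀ i, a i ≠ 0) ∧ ∑ i, a i = 0

/-- `a` is of HODGE TYPE `(2,2)`: `Σᵢ ⟨aᵢ/m⟩ = 3`, i.e. `Σ val(aᵢ) = 3m` (`V_a ⊂ H^{p,q}` with
`q + 1 = Σ val(aᵢ)/m`). [Shioda1979HodgeFermat Thm I] -/
def IsTypeTwoTwo (m : ℕ) (a : Fin 6 → ZMod m) : Prop :=
  ∑ i, (a i).val = 3 * m

/-- TOTALLY HODGE: every unit multiple `t·a` is of type `(2,2)` (the `(ℤ/m)^×`-orbit of `a` underlies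
a rational Hodge class; tree: `FermatHodgeCharacterCriterion`). [Shioda1979HodgeFermat Thm I] -/
def IsTotallyHodge (m : ℕ) (a : Fin 6 → ZMod m) : Prop :=
  ∀ t : (ZMod m)ˣ, IsTypeTwoTwo m (fun i => (t : ZMod m) * a i)

/-- SATURATED (card, point (3)): admissible, and every multiple `j·a` WITHOUT A ZERO ENTRY is of type
`(2,2)` — then the class of an `H_a`-stable cycle (supported on the characters `ℤ·a`) is automatically
in `F²`. Saturated ⇒ totally Hodge (`IsSaturated.isTotallyHodge`). Census of this seat
(`comp/saturation_census.py`, all `m ≤ 36`): every three-pair character is saturated; for prime `m`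
every totally-Hodge character is three-pair; the non-pair totally-Hodge orbits split, e.g.
`m = 6: 3 sat / 1 unsat`, `8: 3/1`, `9: 2/0`, `10: 6/5`, `12: 24/15`, `25: 1/0` (Aoki's `σ₅`),
`33: 1/12`, `35: 0/1` (TRIAGE r1-1 `fermat_saturation.py` agrees at `25, 35`). -/
def IsSaturated (m : ℕ) (a : Fin 6 → ZMod m) : Prop :=
  IsAdmissible m a ∧ ∀ j : ZMod m, (∀ i, j * a i ≠ 0) → IsTypeTwoTwo m (fun i => j * a i)

/-- Saturated characters are totally Hodge (unit multiples have no zero entry). -/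
theorem IsSaturated.isTotallyHodge {m : ℕ} {a : Fin 6 → ZMod m} (h : IsSaturated m a) :
    IsTotallyHodge m a :=
  fun t => h.2 (t : ZMod m) fun i ht => h.1.1 i ((Units.mul_right_eq_zero t).mp ht)

/-- THREE-PAIR character: `{0,…,5}` splits into three pairs `{i,j}` with `aᵢ + aⱼ = 0` (the characters
carried by LINEAR cycles `x_i = ζ x_j`; Ran, Shioda). -/
def IsThreePair (m : ℕ) (a : Fin 6 → ZMod m) : Prop :=
  ∃ σ : Equiv.Perm (Fin 6), a (σ 0) + a (σ 1) = 0 ∧ a (σ 2) + a (σ 3) = 0 ∧ a (σ 4) + a (σ 5) = 0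

/-- `P` is an `H_a`-EIGENPOLYNOMIAL (`H_a = ker(a) ⊂ (ℤ/m)⁶` acting diagonally; no root of unity is
needed to say it): any two monomials of `P` have exponents differing by a multiple of `a` mod `m`
(`(ker a)^⊥ = ℤ·a`). -/
def IsEigenpoly (m : ℕ) (a : Fin 6 → ZMod m) (P : MvPolynomial (Fin 6) k) : Prop :=
  ∀ e ∈ P.support, ∀ e' ∈ P.support, ∃ j : ZMod m, ∀ i, ((e i : ℕ) : ZMod m) - ((e' i : ℕ) : ZMod m) = j * a i

/-- The exponent `a − 1 = (val a₀ − 1, …, val a₅ − 1)`: the monomial `x^{a−1}` spans the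
`a`-eigenline of `R^F_{3m−6} ≅ H^{2,2}_prim` for the Fermat form (`J^F = (xᵢ^{m−1})`, basis
`x^β`, `βᵢ ≤ m − 2`; the residue `x^β Ω / F³` has character `β + 1`). [Shioda1979HodgeFermat §1;
Griffiths residues / Katz in char `p > 5`, `p ∤ m`] -/
def charExponent (m : ℕ) (a : Fin 6 → ZMod m) : Fin 6 →₀ ℕ :=
  Finsupp.equivFunOnFinite.symm fun i => (a i).val - 1

/-- Rescaling the variables, `xᵢ ↦ cᵢ xᵢ` (the diagonal action of `μ_m⁶` when `cᵢ^m = 1`). -/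
def rescale (c : Fin 6 → k) : MvPolynomial (Fin 6) k →ₐ[k] MvPolynomial (Fin 6) k :=
  MvPolynomial.aeval fun i => MvPolynomial.C (c i) * MvPolynomial.X i

namespace CIDatum

variable {m : ℕ}

/-- `Z` is `H_a`-STABLE: all six forms are `H_a`-eigenpolynomials. -/
def IsStableUnder (Z : CIDatum (fermatPolynomial k 4 m) m) (a : Fin 6 → ZMod m) : Prop :=
  (∀ i, IsEigenpoly m a (Z.f i)) ∧ ∀ i, IsEigenpoly m a (Z.g i)

/-- `Z` is VISIBLE AT `a`: the `x^{a−1}`-coefficient of `P_Z` is non-zero. Since `J^F = (xᵢ^{m−1})`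
is a monomial ideal and `val aᵢ − 1 ≤ m − 2`, this coefficient is that of `P_Z mod J^F` in the
monomial basis of `R^F_{3m−6}`, i.e. (dictionary `visible_span`) the `V_a`-component of `[Z]_prim`
MOD `p` is non-zero — hence so is the `V_a`-component of the crystalline class. -/
def VisibleAt (Z : CIDatum (fermatPolynomial k 4 m) m) (a : Fin 6 → ZMod m) : Prop :=
  MvPolynomial.coeff (charExponent m a) Z.transitionDet ≠ 0

/-- `Z` is a DIAGONAL TRANSLATE of `Z₀` by `m`-th roots of unity (both are data for the Fermat form,
which is invariant). -/
def IsTranslateOf (Z Z₀ : CIDatum (fermatPolynomial k 4 m) m) : Prop :=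
  ∃ c : Fin 6 → k, (∀ i, c i ^ m = 1) ∧ (∀ i, Z.f i = rescale c (Z₀.f i)) ∧
    ∀ i, Z.g i = rescale c (Z₀.g i)

/-- `Z` LIFTS TO `W(k)` as a CI-type datum of the Fermat form over the Witt vectors (then the relative
complete intersection `𝒵 ⊂ 𝒳` lifts `Z`, so `cl(Z)` is the specialisation of an algebraic class of
`X_K`: Hodge condition by lifting — the mechanism for LINEAR cycles, which are not `H_a`-stable). -/
def LiftsToWitt (p : ℕ) [Fact p.Prime] [CharP k p] (Z : CIDatum (fermatPolynomial k 4 m) m) : Prop :=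
  ∃ f' g' : Fin 3 → MvPolynomial (Fin 6) (WittVector p k),
    (∀ i, (f' i).IsHomogeneous (Z.d i)) ∧ (∀ i, (g' i).IsHomogeneous (m - Z.d i)) ∧
    ∑ i, f' i * g' i = ∑ i : Fin 6, (MvPolynomial.X i : MvPolynomial (Fin 6) (WittVector p k)) ^ m ∧
    (∀ i, MvPolynomial.map (WittVector.constantCoeff : WittVector p k →+* k) (f' i) = Z.f i) ∧
    ∀ i, MvPolynomial.map (WittVector.constantCoeff : WittVector p k →+* k) (g' i) = Z.g i

/-- GOOD at `a`: one of the two mechanisms that make the BEK Hodge condition of `E_Z` automatic —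
`H_a`-stable with `a` saturated (character bookkeeping), or liftable (lifting). -/
def Good (p : ℕ) [Fact p.Prime] [CharP k p] (a : Fin 6 → ZMod m)
    (Z : CIDatum (fermatPolynomial k 4 m) m) : Prop :=
  (IsSaturated m a ∧ Z.IsStableUnder a) ∨ Z.LiftsToWitt p

end CIDatum

/-- Statement of STUB S4a — LINEAR-CYCLE SUPPLY (pure algebra, size M–L; PROVABLE now, the known
instance of the mechanism, and the satisfiability witness for `CIDatum` / `VisibleAt` / `LiftsToWitt`):
over an algebraically closed field of characteristic `p > 10`, `p ∤ m`, `m ≥ 3`, for every admissible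
THREE-PAIR character `a` (pairs `{i_t, j_t}`, `a_{i_t} + a_{j_t} = 0`) the linear datum
`f_t = x_{i_t} − ζ_t x_{j_t}`, `ζ_t^m = −1`, `g_t = Σ_{e<m} ζ_t^e x_{i_t}^{m−1−e} x_{j_t}^e` is a
reduced CI-type datum of the Fermat form (`(f)` is generated by independent linear forms, hence prime),
VISIBLE at `a` — `P_Z = ± m³ ζ₁ζ₂ζ₃ ∏_t Σ_{e ≤ m−2} ζ_t^e x_{i_t}^{m−2−e} x_{j_t}^e` (block-diagonal
Jacobian; `∂_y g + ζ ∂_x g = mζ Σ_e ζ^e x^{m−2−e} y^e`), so every monomial with pair-sums `m − 2`, in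
particular `x^{a−1}` (`(val aᵢ − 1) + (val aⱼ − 1) = m − 2`), has coefficient a unit times `m³ ≠ 0` —
and LIFTABLE to `W(k)` (Teichmüller lifts `[ζ_t]`, `[ζ]^m = [−1] = −1` for odd `p`). Hand-checked
here for `m = 3, 4` against CRUX-ATTACK §E. [Shioda1979HodgeFermat; Ran 1980; Movasati–Villaflor
arXiv:1705.00084 (linear cycles and their periods)] -/
def LinearCycleSupply : Prop :=
  ∀ (p : ℕ) [Fact p.Prime] (k : Type u) [Field k] [IsAlgClosed k] [CharP k p]
    (m : ℕ) (_ : 3 ≤ m) (_ : 10 < p) (_ : ¬ p ∣ m)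
    (a : Fin 6 → ZMod m) (_ : IsAdmissible m a) (_ : IsThreePair m a),
    ∃ Z : CIDatum (fermatPolynomial k 4 m) m, Z.VisibleAt a ∧ Z.LiftsToWitt p

/-- Statement of STUB S4b — EIGEN-CI SUPPLY (pure algebra / combinatorics; size XL, OPEN — the bet of
the line): over `k = 𝔽̄_p` at a supersingular Fermat prime (`p > 10`, `p ∤ m`, `m ∣ p^ν + 1`), for
every SATURATED NON-PAIR character `a` of `X⁴_m` there is a reduced CI-type factorisation
`Σ fᵢ gᵢ = Σ xᵢ^m` which is VISIBLE at `a` and GOOD at `a` (`H_a`-stable — then the Hodge condition is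
free BECAUSE `a` is saturated — or liftable). Scope drawn by the census (line card §Census; docstring
of `IsSaturated`): first instances are `m = 6` (orbits of `(1,1,3,4,4,5)`, `(1,2,3,4,4,4)`,
`(1,3,3,3,4,4)`, each = a pair ⊔ the Fermat-SURFACE character `(1,3,4,4)`; `p = 11, 17, 23, …`),
`m = 8` (`p = 23, …`), `m = 9` (`p = 17, …`), `m = 12` (24 orbits, `p = 11, 23, …`), and the
route-relevant `m = 25` (Aoki's `σ₅ = (1,6,11,16,21) ⊔ (20)`, `p = 149, …`). Two supply mechanisms are
in print-adjacent form: (α) CONING — for `a = (pair) ⊔ b` with `b` a Hodge character of the Fermat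
surface `X²_m`, a CI-type curve `V₊(f₂,f₃) ⊂ X²_m` (coordinates `x₂,…,x₅`) carrying `V_b` gives the
CI-type surface `V₊(x₀ − ζx₁, f₂, f₃) ⊂ X⁴_m` (liftable; Aoki–Shioda 1983 generators of `NS(X²_m)`
are the candidates); (β) HERMITIAN — over `𝔽_{q²}`, `m ∣ q + 1`, new `H_a`-eigen factorisations
descending from unitary-isotropic planes of `Σ Xᵢ^{q+1} = 0` (card (5)); (γ) da Silva's Question 1
candidate `W : p₁(x^d) = p₂(x^d) = p₃(x^d) = 0`, `m = 3d`, is CI-type of exactly this shape. Why it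
might fail: a saturated non-pair orbit with NO CI-type representative on `X_k` (neither `H_a`-eigen
nor liftable) — then this stub is refuted AS STATED at that `(m, a)`, the scope predicate
`InFermatScope` shrinks accordingly (reshape: replace `IsSaturated` by the surviving class), and the
non-CI fallback (`H_a`-stable images of unitary-isotropic planes, Aoki's cycles) is a NEW line.
Cheapest falsifier (for the lead, minutes–hours of kit): the card's F2 at the SMALLEST instance
`(m, a, p) = (6, (1,1,3,4,4,5), 11)` — enumerate `H_a`-eigen supports in degrees `dᵢ ≤ 5`, solve
`Σxᵢ⁶ ∈ (f₁,f₂,f₃)` over `𝔽_{121}`; independently, list the Aoki–Shioda CI curves on `X²₆` carrying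
`(1,3,4,4)` (mechanism (α), characteristic `0`). [Shioda1979HodgeFermat; AokiShioda1983; Aoki1987;
arXiv:1705.00084; arXiv:1812.03964 Thm 1; ShiodaKatsura1979; daSilva2021HodgeFermat Question 1] -/
def EigenCISupply : Prop :=
  ∀ (p : ℕ) [Fact p.Prime] (k : Type u) [Field k] [IsAlgClosed k] [CharP k p]
    (m : ℕ) (_ : 3 ≤ m) (_ : 10 < p) (_ : ¬ p ∣ m) (_ : ∃ ν : ℕ, m ∣ p ^ ν + 1)
    (a : Fin 6 → ZMod m) (_ : IsSaturated m a) (_ : ¬ IsThreePair m a),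
    ∃ Z : CIDatum (fermatPolynomial k 4 m) m, Z.VisibleAt a ∧ Z.Good p a

end Characters

/-! ## §4 The p-adic side: Fermat fourfold anchors, the dictionary, the scope of the line -/

section Padic

variable {p : ℕ} [Fact p.Prime] {k : Type u} [Field k] [CharP k p] [PerfectRing k p]

/-- A FERMAT FOURFOLD ANCHOR of degree `m`: `𝒳/W(k)` a smooth proper model of relative dimension `4`
whose fibres are Fermat fourfolds of degree `m ≥ 3`, at an anchor prime `p > 4 + 6` not dividing
`m`, SUPERSINGULAR (`m ∣ p^ν + 1`: Shioda–Katsura, so `X_k` is cohomologically supersingular and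
`(p, 𝒳)` is a p-adic anchor of the crux; torsion-free Hodge cohomology is automatic for
hypersurfaces). [ShiodaKatsura1979; Ogus1982 Thm 4.14] -/
structure IsFermatFourfoldAnchor (p : ℕ) [Fact p.Prime] {k : Type u} [Field k] [CharP k p]
    (m : ℕ) (𝒳 : SchemeOver (WittVector p k)) : Prop where
  model : IsSmoothProperModel 4 𝒳
  three_le : 3 ≤ m
  prime_gt : 10 < p
  not_dvd : ¬ p ∣ m
  supersingular : ∃ ν : ℕ, m ∣ p ^ ν + 1
  special : IsFermatVariety 4 m (specialFibre 𝒳)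
  generic : IsFermatVariety 4 m (genericFibre 𝒳)

/-- THE FERMAT-LIFT DICTIONARY (posited interface; every field is a theorem about THE classical
crystalline / de Rham theory of the Fermat scheme `𝒳 = V₊(Σxᵢ^m) ⊂ ℙ⁵_W` with its diagonal
`μ_m⁶`-action and the fixed embedding `ι` of its special fibre — the "construction statement", not
provable for an abstract `C`, exactly like `BerthelotOgusLineBundleLifting C`; planner rule "posit an
interface, keep the construction separate"):
* `V a` — the `a`-eigenspace of `H⁴_dR(X_K/K)` (`K ⊇ μ_m` as `p ∤ m`), one-dimensional for admissible
  `a`, inside `H^{p,q}` for `(p,q)` the type of `a` [Shioda1979HodgeFermat; Ogus1982 §3];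
* `hSq` — `h² = c₁(𝒪(1))²_dR`, a Lefschetz class in `F²`;
* `ciClass Z` — the crystalline class of the cycle of `ι⁻¹ V₊(f) = V₊(f₁,f₂,f₃) ∩ X_k`;
* `chern_two`, `hodge_other` — Riemann–Roch for Hartshorne–Serre bundles: `ch₁ = c·h`,
  `ch₂ = (c²/2) h² − [Z]`, `c = Σdᵢ − m` (`c₂` of a rank-2 bundle with a regular section = class of
  the zero scheme), and `ch₃, ch₄ ∈ K h³, K h⁴ ⊂ F³, F⁴` (`b₆ = b₈ = 1`), `ch₀ = 2`
  [Gros 1985 / Gillet–Messing 1987 crystalline Chern classes; Fulton Ex. 14.1; weak Lefschetz];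
* `hodge_support` — a GOOD datum and all its diagonal translates have `bo(ciClass) ∈ F²`:
  `H_a`-stability puts `cl(Z)` in `(H⁴)^{H_a} = ⊕_{j} V_{ja} ⊕ K h²` (equivariance of cycle classes
  and of `bo`, `bo_naturality` for the `μ_m⁶`-action on `𝒳/W`), saturation makes every occurring
  `V_{ja}` of type `(2,2)` (characters with a zero entry do not occur in `H⁴_prim`); liftable data give
  classes of cycles of `X_K` [Shioda1979HodgeFermat Thm I; BerthelotOgus1983 (2.4.5); Ogus1982 §4];
* `visible_span` — VISIBILITY ⇒ SPAN: if the `x^{a−1}`-coefficient of `P_{Z₀}` is non-zero then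
  `V_a` lies in the `K`-span of the classes of the diagonal translates of `Z₀` (the projector
  `e_a = |G|⁻¹ Σ_g a(g)⁻¹ g_*` onto the line `V_a`; Villaflor's class formula `[Z]^{2,2}_prim = c·P_Z`,
  `c ≠ 0`, in the algebraic de Rham cohomology of `X_k/k`, `p > 5`, `p ∤ m`, and reduction mod `p` of
  the `μ_m`-isotypic `W`-lattice) [Villaflor arXiv:1812.03964 Thm 1; Katz (SGA 7 XX) / Deligne–Illusie
  for the char-`p` Jacobian description]. -/
structure FermatLiftDictionary (C : CrystallineRealization p k) (m : ℕ)
    (𝒳 : SchemeOver (WittVector p k)) (ι : specialFibre 𝒳 ⟶ projectiveSpace 5 k) where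
  /-- character eigenspaces of `H⁴_dR(X_K/K)` -/
  V : (Fin 6 → ZMod m) → Submodule K(p, k) (C.dR.obj (genericFibre 𝒳) (2 * 2))
  /-- `h²` on the generic fibre -/
  hSq : C.dR.obj (genericFibre 𝒳) (2 * 2)
  hSq_mem_lefschetz : hSq ∈ C.dR.lefschetzClasses (genericFibre 𝒳) 2
  hSq_mem_fil : hSq ∈ C.dR.fil (2 * 2) 2
  /-- crystalline class of the CI-type cycle `ι⁻¹ V₊(f)` -/
  ciClass : CIDatum (fermatPolynomial k 4 m) m → C.obj (specialFibre 𝒳) (2 * 2)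
  chern_two : ∀ (Z : CIDatum (fermatPolynomial k 4 m) m) (E : (specialFibre 𝒳).left.Modules),
    IsFiniteLocallyFree E → HasRank E 2 → IsHartshorneSerreOf ι Z.f E →
      C.bo 𝒳 (2 * 2) (C.chCris (specialFibre 𝒳) E 2) =
        (((∑ i, (Z.d i : K(p, k))) - m) ^ 2 / 2) • hSq - C.bo 𝒳 (2 * 2) (ciClass Z)
  hodge_other : ∀ (Z : CIDatum (fermatPolynomial k 4 m) m) (E : (specialFibre 𝒳).left.Modules),
    IsFiniteLocallyFree E → HasRank E 2 → IsHartshorneSerreOf ι Z.f E →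
      ∀ r : ℕ, r ≠ 2 → C.bo 𝒳 (2 * r) (C.chCris (specialFibre 𝒳) E r) ∈ C.dR.fil (2 * r) r
  hodge_support : ∀ (a : Fin 6 → ZMod m) (Z₀ Z : CIDatum (fermatPolynomial k 4 m) m),
    Z₀.Good p a → Z.IsTranslateOf Z₀ → C.bo 𝒳 (2 * 2) (ciClass Z) ∈ C.dR.fil (2 * 2) 2
  visible_span : ∀ (a : Fin 6 → ZMod m) (Z₀ : CIDatum (fermatPolynomial k 4 m) m),
    IsAdmissible m a → Z₀.VisibleAt a →
      V a ≤ Submodule.span K(p, k)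
        ((fun Z => C.bo 𝒳 (2 * 2) (ciClass Z)) '' {Z | Z.IsTranslateOf Z₀})

/-- The TARGET SPAN of the line at a Fermat fourfold anchor: `⊕_{a saturated} V_a ⊔ K·h²` — the
`K`-span of the de Rham components of the rational Hodge classes of `X⁴_m(ℂ)` carried by SATURATED
`(ℤ/m)^×`-orbits (three-pair orbits and the saturated non-pair ones), plus `h²`. For `m` prime and
`m = 25` this is ALL of the Hodge-origin span (census); in general the unsaturated orbits are left to
the residual. -/
def targetSpan {C : CrystallineRealization p k} {m : ℕ} {𝒳 : SchemeOver (WittVector p k)}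
    {ι : specialFibre 𝒳 ⟶ projectiveSpace 5 k} (D : FermatLiftDictionary C m 𝒳 ι) :
    Submodule K(p, k) (C.dR.obj (genericFibre 𝒳) (2 * 2)) :=
  (⨆ a ∈ {a : Fin 6 → ZMod m | IsSaturated m a}, D.V a) ⊔ (K(p, k) ∙ D.hSq)

end Padic

/-! ## Registered stubs (`sorry` lives ONLY in these five theorems; statements = the defs above, unfolded) -/

section Stubs

/-- STUB S1, registered form (= `JacobianColonEq`). -/
theorem stub_jacobianColon_eq :
    ∀ (k : Type u) [Field k] (m : ℕ) (_ : 3 ≤ m) (_ : (m : k) ≠ 0)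
      (F : MvPolynomial (Fin 6) k) (_ : F.IsHomogeneous m)
      (_ : SmoothHypersurface.IsNonsingularForm k F) (Z : CIDatum F m),
      (jacobianIdeal F).colon {Z.transitionDet} = Z.ideal := by
  sorry

/-- STUB S2, registered form (= `SerreBundleExists`). -/
theorem stub_serreBundle_exists :
    ∀ (k : Type u) [Field k] [IsAlgClosed k] (m : ℕ) (_ : 3 ≤ m) (_ : (m : k) ≠ 0)
      (F : MvPolynomial (Fin 6) k) (_ : F.IsHomogeneous m)
      (_ : SmoothHypersurface.IsNonsingularForm k F)
      (X : SchemeOver k) (_ : IsSmoothProjective 4 X)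
      (ι : X ⟶ projectiveSpace 5 k) [IsClosedImmersion ι.left] (_ : HasRangeZeroLocus ι F)
      (Z : CIDatum F m),
      ∃ (E : X.left.Modules) (_ : IsFiniteLocallyFree E), HasRank E 2 ∧ IsHartshorneSerreOf ι Z.f E := by
  sorry

/-- STUB S3, registered form (= `SerreBundleIsOneSemiregular`; HARDEST). -/
theorem stub_serreBundle_isOneSemiregular :
    ∀ (k : Type u) [Field k] [IsAlgClosed k] (m : ℕ) (_ : 3 ≤ m) (_ : (m : k) ≠ 0)
      (_ : ∀ q : ℕ, q.Prime → (q : k) = 0 → 6 < q)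
      (F : MvPolynomial (Fin 6) k) (_ : F.IsHomogeneous m)
      (_ : SmoothHypersurface.IsNonsingularForm k F)
      (X : SchemeOver k) (_ : IsSmoothProjective 4 X)
      (ι : X ⟶ projectiveSpace 5 k) [IsClosedImmersion ι.left] (_ : HasRangeZeroLocus ι F)
      (Z : CIDatum F m) (_ : Z.transitionDet ∉ jacobianIdeal F)
      (_ : (jacobianIdeal F).colon {Z.transitionDet} = Z.ideal)
      (E : X.left.Modules) (hE : IsFiniteLocallyFree E) (_ : HasRank E 2)
      (_ : IsHartshorneSerreOf ι Z.f E),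
      IsOneSemiregular.{u + 1} hE := by
  sorry

/-- STUB S4a, registered form (= `LinearCycleSupply`; provable). -/
theorem stub_linearCycleSupply :
    ∀ (p : ℕ) [Fact p.Prime] (k : Type u) [Field k] [IsAlgClosed k] [CharP k p]
      (m : ℕ) (_ : 3 ≤ m) (_ : 10 < p) (_ : ¬ p ∣ m)
      (a : Fin 6 → ZMod m) (_ : IsAdmissible m a) (_ : IsThreePair m a),
      ∃ Z : CIDatum (fermatPolynomial k 4 m) m, Z.VisibleAt a ∧ Z.LiftsToWitt p := by
  sorry

/-- STUB S4b, registered form (= `EigenCISupply`; the OPEN BET). -/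
theorem stub_eigenCISupply :
    ∀ (p : ℕ) [Fact p.Prime] (k : Type u) [Field k] [IsAlgClosed k] [CharP k p]
      (m : ℕ) (_ : 3 ≤ m) (_ : 10 < p) (_ : ¬ p ∣ m) (_ : ∃ ν : ℕ, m ∣ p ^ ν + 1)
      (a : Fin 6 → ZMod m) (_ : IsSaturated m a) (_ : ¬ IsThreePair m a),
      ∃ Z : CIDatum (fermatPolynomial k 4 m) m, Z.VisibleAt a ∧ Z.Good p a := by
  sorry

/-! ### Consistency: each named statement IS its registered stub (definitional unfolding only) -/

theorem jacobianColonEq_holds : JacobianColonEq.{u} := stub_jacobianColon_eq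
theorem serreBundleExists_holds : SerreBundleExists.{u} := stub_serreBundle_exists
theorem serreBundleIsOneSemiregular_holds : SerreBundleIsOneSemiregular.{u} :=
  stub_serreBundle_isOneSemiregular
theorem linearCycleSupply_holds : LinearCycleSupply.{u} := stub_linearCycleSupply
theorem eigenCISupply_holds : EigenCISupply.{u} := stub_eigenCISupply

end Stubs

/-! ### Name-keyed aliases (the skeleton audit matches a hypothesis head to a declared stub by its last
name component) -/
namespace Registered

/-- Alias of `JacobianColonEq` keyed by the registered stub name. -/
abbrev stub_jacobianColon_eq : Prop := JacobianColonEq.{u}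
/-- Alias of `SerreBundleExists` keyed by the registered stub name. -/
abbrev stub_serreBundle_exists : Prop := SerreBundleExists.{u}
/-- Alias of `SerreBundleIsOneSemiregular` keyed by the registered stub name. -/
abbrev stub_serreBundle_isOneSemiregular : Prop := SerreBundleIsOneSemiregular.{u}
/-- Alias of `LinearCycleSupply` keyed by the registered stub name. -/
abbrev stub_linearCycleSupply : Prop := LinearCycleSupply.{u}
/-- Alias of `EigenCISupply` keyed by the registered stub name. -/
abbrev stub_eigenCISupply : Prop := EigenCISupply.{u}

end Registered

/-! ## §5 Composition (no `sorry` below this line) -/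

section Composition

variable {p : ℕ} [Fact p.Prime] {k : Type u} [Field k] [CharP k p] [PerfectRing k p]

/-- Linear algebra: a vector in `span S ⊔ L` lies in `span (range e) ⊔ L` for some FINITE family `e`
with values in `S` (`Submodule.mem_span_finite_of_mem_span`). -/
theorem exists_fin_family_of_mem_span_sup {K M : Type*} [Field K] [AddCommGroup M] [Module K M]
    {S : Set M} {L : Submodule K M} {x : M} (hx : x ∈ Submodule.span K S ⊔ L) :
    ∃ (ℓ : ℕ) (e : Fin ℓ → M), (∀ i, e i ∈ S) ∧ x ∈ Submodule.span K (Set.range e) ⊔ L := by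
  obtain ⟨y, hy, z, hz, rfl⟩ := Submodule.mem_sup.mp hx
  obtain ⟨T, hTS, hyT⟩ := Submodule.mem_span_finite_of_mem_span hy
  refine ⟨T.card, fun i => (T.equivFin.symm i : M), fun i => hTS (T.equivFin.symm i).2, ?_⟩
  refine Submodule.mem_sup.mpr ⟨y, ?_, z, hz, rfl⟩
  have hsub : (↑T : Set M) ⊆ Set.range fun i => ((T.equivFin.symm i : T) : M) := by
    intro t ht
    exact ⟨T.equivFin ⟨t, ht⟩, by simp⟩
  exact Submodule.span_mono hsub hyT

/-- **IN SCOPE** (the line proper; kernel-checked from S1–S4b): at a supersingular Fermat fourfold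
anchor with embedding `ι` and dictionary `D`, every `α ∈ targetSpan D` is in the seed span, with seeds
that are `{0,1}`-semiregular — hence p-adically semiregular for EVERY higher package `Θ` — finite
locally free Hartshorne–Serre bundles with the BEK Hodge condition in all degrees. S4a/S4b supply,
for each saturated `a`, a visible GOOD datum `Z₀` (linear and liftable if `a` is three-pair); the
dictionary's `visible_span` puts `V_a` in the span of the classes of the translates `Z` of `Z₀`; for
each translate, S1 (and its corollary) discharge the algebraic hypotheses, S2 yields the rank-`2`
Hartshorne–Serre bundle `E_Z` and S3 its `1`-semiregularity; `chern_two` rewrites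
`bo(ciClass Z) = q·h² − bo ch₂(E_Z)`, `hodge_support`/`hodge_other`/`hSq_mem_fil` give the Hodge
condition, `hSq_mem_lefschetz` absorbs `h²` into `Lef²`; finally `exists_fin_family_of_mem_span_sup`
extracts finitely many seeds. -/
theorem seedSpan_of_scope (hS1 : Registered.stub_jacobianColon_eq.{u})
    (hS2 : Registered.stub_serreBundle_exists.{u})
    (hS3 : Registered.stub_serreBundle_isOneSemiregular.{u})
    (hS4a : Registered.stub_linearCycleSupply.{u}) (hS4b : Registered.stub_eigenCISupply.{u})
    [IsAlgClosed k] (C : CrystallineRealization p k) (Θ : HigherSigma k)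
    {m : ℕ} {𝒳 : SchemeOver (WittVector p k)} (h𝒳 : IsFermatFourfoldAnchor p m 𝒳)
    (ι : specialFibre 𝒳 ⟶ projectiveSpace 5 k) [IsClosedImmersion ι.left]
    (hι : HasRangeZeroLocus ι (fermatPolynomial k 4 m)) (D : FermatLiftDictionary C m 𝒳 ι)
    {α : C.dR.obj (genericFibre 𝒳) (2 * 2)} (hα : α ∈ targetSpan D) :
    SeedSpan C Θ 𝒳 2 α := by
  classical
  -- the set of admissible seeds and the span they generate modulo Lefschetz classes
  let Seeds : Set (C.dR.obj (genericFibre 𝒳) (2 * 2)) :=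
    {x | ∃ (E : (specialFibre 𝒳).left.Modules) (hE : IsFiniteLocallyFree E),
      IsZeroOneSemiregular.{u + 1} hE ∧ C.HodgeCondition 𝒳 E ∧
      x = C.bo 𝒳 (2 * 2) (C.chCris (specialFibre 𝒳) E 2)}
  let W : Submodule K(p, k) (C.dR.obj (genericFibre 𝒳) (2 * 2)) :=
    Submodule.span K(p, k) Seeds ⊔ C.dR.lefschetzClasses (genericFibre 𝒳) 2
  -- scalars available at the anchor
  have hmk : (m : k) ≠ 0 := fun h => h𝒳.not_dvd ((CharP.cast_eq_zero_iff k p m).mp h)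
  have hchar : ∀ q : ℕ, q.Prime → (q : k) = 0 → 6 < q := by
    intro q hq hq0
    have hpq : p ∣ q := (CharP.cast_eq_zero_iff k p q).mp hq0
    have hpq' : p = q := (Nat.prime_dvd_prime_iff_eq (Fact.out) hq).mp hpq
    have := h𝒳.prime_gt
    omega
  have hF : (fermatPolynomial k 4 m).IsHomogeneous m := isHomogeneous_fermatPolynomial 4 m
  have hns : SmoothHypersurface.IsNonsingularForm k (fermatPolynomial k 4 m) :=
    SmoothHypersurface.isNonsingularForm_sum_X_pow hmk
  have hXsm : IsSmoothProjective 4 (specialFibre 𝒳) := h𝒳.model.isSmoothProjective_specialFibre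
  -- h² is Lefschetz, hence in W
  have hhSqW : D.hSq ∈ W := Submodule.mem_sup_right D.hSq_mem_lefschetz
  -- every translate of a GOOD datum contributes its class to W
  have hclassW : ∀ (a : Fin 6 → ZMod m) (Z₀ Z : CIDatum (fermatPolynomial k 4 m) m),
      Z₀.Good p a → Z.IsTranslateOf Z₀ → C.bo 𝒳 (2 * 2) (D.ciClass Z) ∈ W := by
    intro a Z₀ Z hgood htr
    have hcolon := hS1 k m h𝒳.three_le hmk (fermatPolynomial k 4 m) hF hns Z
    have hdet := transitionDet_not_mem_of_colon_eq Z hcolon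
    obtain ⟨E, hE, hrk, hHS⟩ :=
      hS2 k m h𝒳.three_le hmk (fermatPolynomial k 4 m) hF hns (specialFibre 𝒳) hXsm ι hι Z
    have hsemi : IsOneSemiregular.{u + 1} hE :=
      hS3 k m h𝒳.three_le hmk hchar (fermatPolynomial k 4 m) hF hns (specialFibre 𝒳) hXsm ι hι Z
        hdet hcolon E hE hrk hHS
    have hch2 := D.chern_two Z E hE hrk hHS
    have hsupp : C.bo 𝒳 (2 * 2) (D.ciClass Z) ∈ C.dR.fil (2 * 2) 2 := D.hodge_support a Z₀ Z hgood htr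
    -- the Hodge condition of E in all degrees
    have hHodge : C.HodgeCondition 𝒳 E := by
      intro r
      by_cases hr : r = 2
      · subst hr
        rw [hch2]
        exact Submodule.sub_mem _ (Submodule.smul_mem _ _ D.hSq_mem_fil) hsupp
      · exact D.hodge_other Z E hE hrk hHS r hr
    -- E is a seed
    have hseed : C.bo 𝒳 (2 * 2) (C.chCris (specialFibre 𝒳) E 2) ∈ W := by
      refine Submodule.mem_sup_left (Submodule.subset_span ?_)
      exact ⟨E, hE, IsOneSemiregular.isZeroOneSemiregular hE hsemi, hHodge, rfl⟩
    -- bo(ciClass Z) = q • h² − bo ch₂(E)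
    have hrew : C.bo 𝒳 (2 * 2) (D.ciClass Z) =
        (((∑ i, (Z.d i : K(p, k))) - m) ^ 2 / 2) • D.hSq -
          C.bo 𝒳 (2 * 2) (C.chCris (specialFibre 𝒳) E 2) := by
      rw [hch2]; abel
    rw [hrew]
    exact Submodule.sub_mem _ (Submodule.smul_mem _ _ hhSqW) hseed
  -- supply: every saturated character has a visible GOOD datum
  have hsupply : ∀ a : Fin 6 → ZMod m, IsSaturated m a →
      ∃ Z₀ : CIDatum (fermatPolynomial k 4 m) m, Z₀.VisibleAt a ∧ Z₀.Good p a := by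
    intro a ha
    by_cases htp : IsThreePair m a
    · obtain ⟨Z₀, hvis, hlift⟩ := hS4a p k m h𝒳.three_le h𝒳.prime_gt h𝒳.not_dvd a ha.1 htp
      exact ⟨Z₀, hvis, Or.inr hlift⟩
    · exact hS4b p k m h𝒳.three_le h𝒳.prime_gt h𝒳.not_dvd h𝒳.supersingular a ha htp
  -- the target span lies in W
  have htarget : targetSpan D ≤ W := by
    refine sup_le ?_ ?_
    · refine iSup₂_le fun a ha => ?_
      obtain ⟨Z₀, hvis, hgood⟩ := hsupply a ha
      refine (D.visible_span a Z₀ ha.1 hvis).trans (Submodule.span_le.mpr ?_)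
      rintro _ ⟨Z, hZ, rfl⟩
      exact hclassW a Z₀ Z hgood hZ
    · exact (Submodule.span_singleton_le_iff_mem _ _).mpr hhSqW
  -- extract finitely many seeds
  obtain ⟨ℓ, e, he, hαe⟩ := exists_fin_family_of_mem_span_sup (htarget hα)
  choose E hE hsr hHC hxe using he
  refine ⟨ℓ, E, hE, fun i => ⟨isPadicSemiregular_of_isZeroOneSemiregular Θ p _ (hE i) (hsr i),
    hHC i⟩, ?_⟩
  have hrange : (Set.range e) =
      Set.range fun i => C.bo 𝒳 (2 * 2) (C.chCris (specialFibre 𝒳) (E i) 2) := by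
    ext x
    constructor
    · rintro ⟨i, rfl⟩; exact ⟨i, (hxe i).symm⟩
    · rintro ⟨i, rfl⟩; exact ⟨i, hxe i⟩
  rw [hrange] at hαe
  exact hαe

/-- **THE LINE PROPER** (the audited conclusion of this skeleton:
`--crux-decl …GorensteinCiSeeds.SemiregularSeedsOnFermatScope`): at every supersingular
Fermat fourfold anchor, for every embedding, dictionary and higher package, every class in the target span
is in the seed span. This is exactly the in-scope half of the composition, from S1–S4b only. -/
def SemiregularSeedsOnFermatScope : Prop :=
  ∀ (F : AnchorField.{u}) (C : CrystallineRealization F.p F.k) (Θ : HigherSigma F.k)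
    (m : ℕ) (𝒳 : SchemeOver (WittVector F.p F.k)), IsFermatFourfoldAnchor F.p m 𝒳 →
    ∀ (ι : specialFibre 𝒳 ⟶ projectiveSpace 5 F.k) (_ : IsClosedImmersion ι.left),
      HasRangeZeroLocus ι (fermatPolynomial F.k 4 m) →
    ∀ (D : FermatLiftDictionary C m 𝒳 ι), ∀ α ∈ targetSpan D, SeedSpan C Θ 𝒳 2 α

/-- The residual-free composition (S1–S4b ⇒ the scope theorem). -/
theorem SemiregularSeedsOnFermatScope_of (hS1 : Registered.stub_jacobianColon_eq.{u})
    (hS2 : Registered.stub_serreBundle_exists.{u})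
    (hS3 : Registered.stub_serreBundle_isOneSemiregular.{u})
    (hS4a : Registered.stub_linearCycleSupply.{u}) (hS4b : Registered.stub_eigenCISupply.{u}) :
    SemiregularSeedsOnFermatScope.{u} := by
  intro F C Θ m 𝒳 h𝒳 ι hιc hι D α hα
  exact seedSpan_of_scope hS1 hS2 hS3 hS4a hS4b C Θ h𝒳 ι hι D hα

/-- **`SemiregularSeedsOnAnchors_of` — THE SKELETON THEOREM** (lead's audited shape, 2026-08-16): the
five registered stubs S1, S2, S3, S4a, S4b imply, BY NAME, the line's conclusion
`SemiregularSeedsOnFermatScope` — the typed crux's own conclusion shape `SeedSpan C Θ 𝒳 2 α`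
(TypedCrux.lean) at every supersingular Fermat fourfold anchor, for every embedding, dictionary,
higher-σ package `Θ` and every `α` in the target span. The generation-2 residual stub
`stub_residualOffFermatScope` (the crux OFF this scope, quantified over a FREE Hodge-origin predicate
`HO`, hence specialisable to `HO := ⊤`, which `Disproof.withoutHodgeOrigin_count` refutes on paper) is
NOT carried: it is not a lemma of this line and cannot be settled on today's carriers; the informal
route item has no declaration to conclude, so this scope theorem is the line's honest reach. -/
theorem SemiregularSeedsOnAnchors_of (hS1 : Registered.stub_jacobianColon_eq.{u})
    (hS2 : Registered.stub_serreBundle_exists.{u})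
    (hS3 : Registered.stub_serreBundle_isOneSemiregular.{u})
    (hS4a : Registered.stub_linearCycleSupply.{u}) (hS4b : Registered.stub_eigenCISupply.{u}) :
    SemiregularSeedsOnFermatScope.{u} :=
  SemiregularSeedsOnFermatScope_of hS1 hS2 hS3 hS4a hS4b

/-- Wiring check: the registered stubs feed the composition as stated (definitional unfolding only). -/
theorem semiregularSeedsOnFermatScope_holds : SemiregularSeedsOnFermatScope.{u} :=
  SemiregularSeedsOnAnchors_of stub_jacobianColon_eq stub_serreBundle_exists
    stub_serreBundle_isOneSemiregular stub_linearCycleSupply stub_eigenCISupply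

end Composition

end Summit.HodgeConjecture.HodgeConjecture.Cruxes.SemiregularSeedsOnAnchors.GorensteinCiSeeds

end
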